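import Literature.MathematicalPhysics.QuantumFieldTheory.Balaban1983to89.B5GaussSectC

/-!
# `Balaban1983to89.B5Eq123Constants` — T. Bałaban, *Propagators and renormalization transformations for lattice gauge
theories. I*, Commun. Math. Phys. **95** (1984) 17–40 [Balaban1984PropagatorsI]: the two CONSTANTS of the Faddeev–Popov
passage (1.22) ⟹ (1.23), p. 21 [PDF 5] — the λ′-integral of the axial δ-functions (`z^{(k)} → z′^{(k)}`) and the
denominator of (1.22) («different from 0») — kernel-proved; companion of `B5Eq123FaddeevPopov`

statement-level skeleton of published theorems with citation tags; proofs where landed; nothing here is a claim about the Yang–Mills mass gap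

PDF held: `paper:balaban1984-cmp95-propagators-rt-i` ((1.22)–(1.24) are p. 21 = PDF p. 5, read as an image on the page render
`run/shared/lean/pub/pub-balaban/b2b-balaban-ref1/pages/1984-cmp95-propagators-rt-I/…-p005-x2.png`).

WHAT IS REPRODUCED.  SKELETON row `B5.Eq1.23` ((1.22)–(1.23)), Phase-2 seat p37 (gen 2), SPARE list of PHASE2-TARGETS.md
§G.  `B5Eq123FaddeevPopov` proves the passage (1.17) ⟹ (1.23) by the four printed steps for an abstract gauge action,
under two inputs that the print treats as evident; this file PROVES both inputs:
* (1.23), second `=`: «(∫dλ′ δ(Q′_kλ′)·δ_Ax(Q_{k−1}A + ∂^{L^{−1}}Q′_{k−1}λ′)·…·δ_Ax(A + ∂^ηλ′))» is absorbed into the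
  numerical factor, `z^{(k)} → z′^{(k)}`: the λ′-integral of the axial δ-functions is an `A`-independent constant.  At
  measure level (δ-functions of linear constraints = flat measures of the constraint subspaces, the reading (1.40) p. 25
  of the paper and of `B5GaussSectC`) this says: the orbit map `(λ, s) ↦ s + Dλ` from (restricted gauge group) × (doubly
  constrained fibre directions) to the fibre directions `{Q_k· = 0}` pushes Lebesgue ⊗ Lebesgue forward to a constant
  positive multiple of Lebesgue measure, PROVIDED it is a linear bijection — which is exactly the hierarchical block-axial
  gauge lemma `B5.HierGauge.complete` / `unique` (B5.lean §C.1, GAPS G-B5-01R: for every `A` exactly one `λ ∈ N(Q′_k)`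
  puts all `Q_jA^λ`, `j < k`, in the block axial gauge).  §1 `map_orbitLin_eq_smul` (uniqueness of Haar measure — the
  Jacobian is not computed, as the paper does not compute it), §2 `map_orbit_affine_eq_smul` (the same on the affine fibres
  `{Q_kA = B} = A₀ + F` of the field space: the hypothesis `hFP` of `B5Eq123FaddeevPopov.eq123_measure`).
* (1.22): «we will see that it is different from 0»: §3 — with `∂*(A^λ) = ∂*A − Δλ` (`LatticeFieldCalculus.diverg_gaugeShift`,
  `Δ = ∂*∂`) the denominator `∫dλ δ(Q′_kλ) exp(−(1/2α)⟨∂*A^λ, ∂*A^λ⟩)` is `∫_{N(Q′_k)} γ_α(∂*A − Δλ)dλ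
  = Z_N(α)·exp(−(1/2α)‖∂*A − R∂*A‖²) ∈ (0, ∞)` (`lintegral_feynmanW`, `_ne_zero`, `_ne_top`; this is (1.24) =
  `B5GaussSectC.integral_124` with `B5GaussSectC.ZN_pos`, under «Δ is positive definite on N(Q′_k)» = `Set.InjOn Δ N`,
  discharged for the torus Laplacian by `B5GaussSectC.injOn_torus`), and the continuation (1.23) → (1.27), p. 22:
  `exp(−(1/2α)⟨∂*A, ∂*A⟩)·(∫dλ δ(Q′_kλ) exp(−(1/2α)⟨∂*A^λ, ∂*A^λ⟩))⁻¹ = 𝒢_α(∂*A)` as `ℝ≥0∞`-weights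
  (`feynmanW_mul_inv_lintegral`, by `B5GaussSectC.calG_eq_127`).

TYPING: `Nn`, `S`, `F` finite-dimensional real normed spaces with Borel σ-algebras and add-Haar (Lebesgue) measures
(`N(Q′_k)`, the direction space of the doubly constrained fibre, the direction space `{Q_k· = 0}`); fields `V` any
measurable additive group; `E = L²(T_η)` a finite-dimensional real inner-product space with `N : Submodule ℝ E`,
`Δ : E →ₗ[ℝ] E` exactly as in `B5GaussSectC` §§2–3 (whose torus model §7 instantiates them).  All integrals are lower
Lebesgue integrals of `ℝ≥0∞`-valued weights (`feynmanW α ∂* A = ENNReal.ofReal (γ_α(∂*A))`).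

NOT CERTIFIED HERE: the bijectivity hypothesis for a particular typed carrier (it is `B5.HierGauge` read on that carrier),
the value of the constant, anything of (1.24)–(1.28) beyond the use of `B5GaussSectC` by name.  No statement of the
series is restated; `[folklore]` tags mark pure measure theory.

Unit `lit-balaban-p37` gen 2 (Phase-2 proof seat p37; literature-prover-lit-balaban-p37-g2-0), HOME
`run/shared/lean/pub/lit-balaban/` (STATUS: `lit-balaban-p37/STATUS.md`), 2026-08-21.  v1.1 (same day, append-only; v1 =
p243943, commit d0a92939ec30, byte-identical above §4): §4 — the flat fibre measure is preserved by the restricted gauge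
transformations (hypothesis `hTμ` of `B5Eq123FaddeevPopov.eq123_line1`).
-/

noncomputable section

open MeasureTheory
open scoped ENNReal NNReal

namespace Literature.MathematicalPhysics.QuantumFieldTheory.Balaban1983to89.B5Eq123Constants

/-! ## §1  The Faddeev–Popov constant for LINEAR gauge conditions (the axial δ-functions of (1.17)):
`B5.HierGauge.complete/unique` in measure clothing.  If `λ ↦` (the constraint data of `A^λ`) is a linear BIJECTION
from `N(Q′_k)` onto the constraint values — equivalently the orbit map `N(Q′_k) × S → F`, `(λ, s) ↦ s + Dλ`, from
(gauge parameters) × (the doubly constrained fibre direction `S = {Q_k· = 0, axial}`) onto the fibre direction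
`F = {Q_k· = 0}` is a linear bijection — then flat measure ⊗ flat measure is pushed to a constant positive multiple of
flat measure (uniqueness of Haar measure), whatever Lebesgue normalisations are chosen on `N(Q′_k)`, `S`, `F`. -/

section Linear

/-- The orbit map of a linear (abelian, translation) gauge action on the fibre directions:
`(λ, s) ↦ ι s + D λ` (`ι` = inclusion of the doubly constrained directions, `D` = `λ ↦ −∂λ` restricted to `N(Q′_k)`).
[cite: Balaban1984PropagatorsI, (1.20)–(1.23) pp.20–21] -/
def orbitLin {Nn S F : Type*} [AddCommGroup Nn] [Module ℝ Nn] [AddCommGroup S] [Module ℝ S]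
    [AddCommGroup F] [Module ℝ F] (ι : S →ₗ[ℝ] F) (D : Nn →ₗ[ℝ] F) : Nn × S →ₗ[ℝ] F :=
  ι.comp (LinearMap.snd ℝ Nn S) + D.comp (LinearMap.fst ℝ Nn S)

/-- Unfolding lemma. [folklore] -/
@[simp] private theorem orbitLin_apply {Nn S F : Type*} [AddCommGroup Nn] [Module ℝ Nn] [AddCommGroup S] [Module ℝ S]
    [AddCommGroup F] [Module ℝ F] (ι : S →ₗ[ℝ] F) (D : Nn →ₗ[ℝ] F) (p : Nn × S) :
    orbitLin ι D p = ι p.2 + D p.1 := rfl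

variable {Nn S F : Type*}
  [NormedAddCommGroup Nn] [NormedSpace ℝ Nn] [FiniteDimensional ℝ Nn] [MeasurableSpace Nn] [BorelSpace Nn]
  [NormedAddCommGroup S] [NormedSpace ℝ S] [FiniteDimensional ℝ S] [MeasurableSpace S] [BorelSpace S]
  [NormedAddCommGroup F] [NormedSpace ℝ F] [FiniteDimensional ℝ F] [MeasurableSpace F] [BorelSpace F]

/-- **The Faddeev–Popov λ′-integral of linear gauge conditions is a positive constant.**  If the orbit map
`(λ, s) ↦ ι s + Dλ` is a linear bijection `N(Q′_k) × S ≃ F` (for the axial gauge of (1.17): every fibre point is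
reached from exactly one axial-gauge point by exactly one `λ ∈ N(Q′_k)` — `B5.HierGauge.complete` / `unique`), then
for add-Haar (Lebesgue) measures `ν`, `σ`, `φ` on `N(Q′_k)`, `S`, `F`:  `orbit_*(ν ⊗ σ) = c · φ` with `0 < c < ∞`.
[cite: Balaban1984PropagatorsI, (1.23) p.21] -/
theorem map_orbitLin_eq_smul (ν : Measure Nn) [ν.IsAddHaarMeasure] (σ : Measure S) [σ.IsAddHaarMeasure]
    (φ : Measure F) [φ.IsAddHaarMeasure] (ι : S →ₗ[ℝ] F) (D : Nn →ₗ[ℝ] F)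
    (hbij : Function.Bijective (orbitLin ι D)) :
    ∃ c : ℝ≥0, 0 < c ∧ (ν.prod σ).map (fun p : Nn × S => ι p.2 + D p.1) = c • φ := by
  let e : (Nn × S) ≃L[ℝ] F := (LinearEquiv.ofBijective (orbitLin ι D) hbij).toContinuousLinearEquiv
  have he : (fun p : Nn × S => ι p.2 + D p.1) = e := by
    funext p; rfl
  rw [he]
  haveI : ((ν.prod σ).map e).IsAddHaarMeasure := e.isAddHaarMeasure_map _
  exact ⟨((ν.prod σ).map e).addHaarScalarFactor φ,
    Measure.addHaarScalarFactor_pos_of_isAddHaarMeasure _ _,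
    Measure.isAddLeftInvariant_eq_smul _ _⟩

end Linear

/-! ## §2  The same constant at the level of the AFFINE fibres `{A : Q_kA = B}` inside the space of all fields:
the hypothesis `orbit_*(dλ δ(Q′_kλ) ⊗ P) = c · dA δ(B − Q_kA)` of `B5Eq123FaddeevPopov.eq123_measure`, for flat fibre measures typed (as in
`B5GaussSectC` / `B5Hk164Transl`) as translates `A₀ + ·` of Lebesgue measures of the direction spaces. -/

section Affine

variable {Nn S F : Type*}
  [NormedAddCommGroup Nn] [NormedSpace ℝ Nn] [FiniteDimensional ℝ Nn] [MeasurableSpace Nn] [BorelSpace Nn]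
  [NormedAddCommGroup S] [NormedSpace ℝ S] [FiniteDimensional ℝ S] [MeasurableSpace S] [BorelSpace S]
  [NormedAddCommGroup F] [NormedSpace ℝ F] [FiniteDimensional ℝ F] [MeasurableSpace F] [BorelSpace F]
  {V : Type*} [AddCommGroup V] [MeasurableSpace V] [MeasurableAdd₂ V]

/-- **The Faddeev–Popov constant on the affine fibre.**  Fields `V`; the fibre `{Q_kA = B} = A₀ + j(F)` through a base
point `A₀` (`j` = the inclusion of the direction space `F = {Q_k· = 0}`), its flat measure `dA δ(B − Q_kA) := (A₀ + j ·)_*φ`;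
the doubly constrained fibre `{Q_kA = B, A axial} = A₀ + j(ι S)` with flat measure `P := (A₀ + j ι ·)_*σ`; the restricted
gauge group acting by translations `A^λ = A + j(Dλ)` (`D = −∂` on `N(Q′_k)`, landing in `F` by (1.20)).  If
`(λ, s) ↦ ι s + Dλ` is a bijection `N(Q′_k) × S ≃ F` (`B5.HierGauge`), then `orbit_*(ν ⊗ P) = c · dA δ(B − Q_kA)` with
`0 < c < ∞` — the hypothesis `hFP` of `B5Eq123FaddeevPopov.eq123_measure`. [cite: Balaban1984PropagatorsI, (1.23) p.21] -/
theorem map_orbit_affine_eq_smul (ν : Measure Nn) [ν.IsAddHaarMeasure] (σ : Measure S) [σ.IsAddHaarMeasure]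
    (φ : Measure F) [φ.IsAddHaarMeasure] (ι : S →ₗ[ℝ] F) (D : Nn →ₗ[ℝ] F)
    (hbij : Function.Bijective (orbitLin ι D))
    (j : F →+ V) (hj : Measurable j) (A₀ : V) (T : Nn → V → V) (hT : ∀ l A, T l A = A + j (D l)) :
    ∃ c : ℝ≥0, 0 < c ∧
      (ν.prod (σ.map fun s => A₀ + j (ι s))).map (fun p : Nn × V => T p.1 p.2)
        = c • φ.map (fun x => A₀ + j x) := by
  obtain ⟨c, hc, hmap⟩ := map_orbitLin_eq_smul ν σ φ ι D hbij
  refine ⟨c, hc, ?_⟩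
  have hιm : Measurable (ι : S → F) := ι.continuous_of_finiteDimensional.measurable
  have hDm : Measurable (D : Nn → F) := D.continuous_of_finiteDimensional.measurable
  have hb : Measurable fun x : F => A₀ + j x := measurable_const.add hj
  have ha : Measurable fun s : S => A₀ + j (ι s) := hb.comp hιm
  have horb : Measurable fun p : Nn × S => ι p.2 + D p.1 :=
    (hιm.comp measurable_snd).add (hDm.comp measurable_fst)
  have hTm : Measurable fun p : Nn × V => T p.1 p.2 := by
    have : (fun p : Nn × V => T p.1 p.2) = fun p => p.2 + j (D p.1) := by funext p; exact hT _ _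
    rw [this]
    exact measurable_snd.add (hj.comp (hDm.comp measurable_fst))
  -- `ν ⊗ (a_*σ) = (id × a)_*(ν ⊗ σ)`
  have h1 : ν.prod (σ.map fun s => A₀ + j (ι s)) =
      (ν.prod σ).map (Prod.map id fun s => A₀ + j (ι s)) := by
    rw [← Measure.map_prod_map ν σ measurable_id ha, Measure.map_id]
  -- the orbit map through the base point factors through the linear orbit map
  have h2 : (fun p : Nn × V => T p.1 p.2) ∘ (Prod.map id fun s => A₀ + j (ι s)) =
      (fun x : F => A₀ + j x) ∘ (fun p : Nn × S => ι p.2 + D p.1) := by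
    funext p
    simp only [Function.comp_apply, Prod.map_fst, Prod.map_snd, id_eq, hT, map_add, add_assoc]
  rw [h1, Measure.map_map hTm (measurable_id.prodMap ha), h2, ← Measure.map_map hb horb, hmap,
    Measure.map_smul]

end Affine

/-! ## §3  «we will see that it is different from 0»: the Feynman-gauge orbit integral of (1.22) is positive and
finite — from (1.24) as certified in `B5GaussSectC` (`integral_124`, `ZN_pos`), for any field space on which the
divergence transforms as `∂*A^λ = ∂*A − Δλ`; and the (1.23) → (1.27) identification of the resulting density with `𝒢_α`. -/

section Feynman

open B5GaussSectC

variable {V : Type*} {E : Type*} [NormedAddCommGroup E]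

/-- The inserted Feynman-gauge weight `h(A) = exp(−(1/2α)⟨∂*A, ∂*A⟩) = γ_α(∂*A)` (as an `ℝ≥0∞`-valued weight;
`dstar A = ∂*A ∈ L²(T_η)`, `γ_α = B5GaussSectC.gaussW`). [cite: Balaban1984PropagatorsI, (1.22) p.21] -/
def feynmanW (α : ℝ) (dstar : V → E) (A : V) : ℝ≥0∞ := ENNReal.ofReal (gaussW E α (dstar A))

/-- Unfolding lemma. [folklore] -/
private theorem feynmanW_def (α : ℝ) (dstar : V → E) (A : V) :
    feynmanW α dstar A = ENNReal.ofReal (gaussW E α (dstar A)) := rfl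

/-- The Feynman weight `exp(−(1/2α)⟨∂*A, ∂*A⟩)` of (1.22) is measurable in the field when `∂*` is. [cite: Balaban1984PropagatorsI, (1.22) p.21] -/
theorem measurable_feynmanW [MeasurableSpace V] [MeasurableSpace E] [OpensMeasurableSpace E] (α : ℝ)
    {dstar : V → E} (hd : Measurable dstar) : Measurable (feynmanW α dstar) :=
  ENNReal.measurable_ofReal.comp ((continuous_gaussW α).measurable.comp hd)

variable [InnerProductSpace ℝ E] [FiniteDimensional ℝ E] [MeasurableSpace E] [BorelSpace E]
  {N : Submodule ℝ E} {Δ : E →ₗ[ℝ] E}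

/-- The λ-integrand `γ_α(∂*A − Δλ)` of (1.24) (= the denominator of (1.22)) is integrable on `N(Q′_k)` (`α > 0`, `Δ`
injective on `N(Q′_k)`). [cite: Balaban1984PropagatorsI, (1.24) p.21] -/
theorem integrable_gaussW_sub (hinj : Set.InjOn Δ N) {α : ℝ} (hα : 0 < α) (f : E) :
    Integrable (fun x : N => gaussW E α (f - Δ x)) := by
  by_contra hni
  have h0 := integral_undef hni
  rw [integral_124] at h0
  exact (mul_pos (ZN_pos hinj hα) (gaussW_pos α _)).ne' h0

/-- **The denominator of (1.22), evaluated by (1.24):**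
`∫dλ δ(Q′_kλ) exp(−(1/2α)⟨∂*A^λ, ∂*A^λ⟩) = Z_N(α) · exp(−(1/2α)‖∂*A − R∂*A‖²)` for the restricted gauge group `N(Q′_k)`
with its Lebesgue measure, whenever `∂*(A^λ) = ∂*A − Δλ`. [cite: Balaban1984PropagatorsI, (1.24) p.21] -/
theorem lintegral_feynmanW (hinj : Set.InjOn Δ N) {α : ℝ} (hα : 0 < α) (T : N → V → V) (dstar : V → E)
    (hd : ∀ (l : N) (A : V), dstar (T l A) = dstar A - Δ l) (A : V) :
    ∫⁻ l : N, feynmanW α dstar (T l A) =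
      ENNReal.ofReal (ZN N Δ α * gaussW E α (dstar A - Rop N Δ (dstar A))) := by
  unfold feynmanW
  simp_rw [hd]
  rw [← integral_124, ofReal_integral_eq_lintegral_ofReal (integrable_gaussW_sub hinj hα _)
    (Filter.Eventually.of_forall fun x => (gaussW_pos α _).le)]

/-- «different from 0»: the denominator of (1.22) is non-zero … [cite: Balaban1984PropagatorsI, p.21] -/
theorem lintegral_feynmanW_ne_zero (hinj : Set.InjOn Δ N) {α : ℝ} (hα : 0 < α) (T : N → V → V) (dstar : V → E)
    (hd : ∀ (l : N) (A : V), dstar (T l A) = dstar A - Δ l) (A : V) :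
    ∫⁻ l : N, feynmanW α dstar (T l A) ≠ 0 := by
  rw [lintegral_feynmanW hinj hα T dstar hd, ne_eq, ENNReal.ofReal_eq_zero, not_le]
  exact mul_pos (ZN_pos hinj hα) (gaussW_pos α _)

/-- … and finite. [cite: Balaban1984PropagatorsI, p.21] -/
theorem lintegral_feynmanW_ne_top (hinj : Set.InjOn Δ N) {α : ℝ} (hα : 0 < α) (T : N → V → V) (dstar : V → E)
    (hd : ∀ (l : N) (A : V), dstar (T l A) = dstar A - Δ l) (A : V) :
    ∫⁻ l : N, feynmanW α dstar (T l A) ≠ ⊤ := by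
  rw [lintegral_feynmanW hinj hα T dstar hd]
  exact ENNReal.ofReal_ne_top

/-- **(1.23) → (1.27):** the density produced by the Faddeev–Popov passage IS the gauge-fixing density,
`exp(−(1/2α)⟨∂*A, ∂*A⟩) · (∫dλ δ(Q′_kλ) exp(−(1/2α)⟨∂*A^λ, ∂*A^λ⟩))⁻¹ = 𝒢_α(∂*A)` (`B5GaussSectC.calG`, (1.39), by
`B5GaussSectC.calG_eq_127`). [cite: Balaban1984PropagatorsI, (1.27) p.22] -/
theorem feynmanW_mul_inv_lintegral (hinj : Set.InjOn Δ N) {α : ℝ} (hα : 0 < α) (T : N → V → V) (dstar : V → E)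
    (hd : ∀ (l : N) (A : V), dstar (T l A) = dstar A - Δ l) (A : V) :
    feynmanW α dstar A * (∫⁻ l : N, feynmanW α dstar (T l A))⁻¹ =
      ENNReal.ofReal (calG N Δ α (dstar A)) := by
  rw [← calG_eq_127 hinj hα, integral_124, lintegral_feynmanW hinj hα T dstar hd, feynmanW_def,
    ← ENNReal.ofReal_inv_of_pos (mul_pos (ZN_pos hinj hα) (gaussW_pos α _)),
    ← ENNReal.ofReal_mul (gaussW_pos α _).le]

end Feynman

/-! ## §4 (v1.1, append-only)  «The δ-function δ(B − Q_kA) is invariant with respect to gauge transformations λ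
satisfying Q′_kλ = 0» (p. 20) together with the translation invariance of `dA`: the flat fibre measure
`dA δ(B − Q_kA) = (A₀ + j ·)_*φ` of `{Q_kA = B} = A₀ + j(F)` is preserved by every translation `A ↦ A + j(v)`, `v ∈ F`,
in particular by the restricted gauge transformations `A^λ = A + j(Dλ)` (`Q_k∂λ = ∂Q′_kλ = 0`, (1.20)) — the hypothesis
`hTμ` of `B5Eq123FaddeevPopov.eq123_line1` for fibre measures typed as translates of Lebesgue measures. -/

section Fibre

variable {Nn F : Type*} [NormedAddCommGroup F] [MeasurableSpace F] [BorelSpace F]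
  {V : Type*} [AddCommGroup V] [MeasurableSpace V] [MeasurableAdd V]

/-- The flat measure of the affine fibre `A₀ + j(F)` is invariant under the translations by `j(F)`.
[cite: Balaban1984PropagatorsI, (1.20) p.20] -/
theorem map_translate_fibre (φ : Measure F) [φ.IsAddHaarMeasure] (j : F →+ V) (hj : Measurable j) (A₀ : V) (v : F) :
    (φ.map fun x => A₀ + j x).map (fun A : V => A + j v) = φ.map fun x => A₀ + j x := by
  have hb : Measurable fun x : F => A₀ + j x := hj.const_add A₀
  have ht : Measurable fun A : V => A + j v := measurable_add_const (j v)
  have hcomp : (fun A : V => A + j v) ∘ (fun x : F => A₀ + j x) = (fun x : F => A₀ + j x) ∘ (fun x : F => x + v) := by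
    funext x
    simp only [Function.comp_apply, map_add, add_assoc]
  rw [Measure.map_map ht hb, hcomp, ← Measure.map_map hb (measurable_add_const v), map_add_right_eq_self]

/-- **`hTμ`**: the restricted gauge transformations `T λ A = A + j(Dλ)` PRESERVE the flat fibre measure `dA δ(B − Q_kA)`
(«The δ-function δ(B − Q_kA) is invariant with respect to gauge transformations λ satisfying Q′_kλ = 0», p. 20, and
`dA` is translation invariant). [cite: Balaban1984PropagatorsI, (1.20) p.20] -/
theorem measurePreserving_gauge_fibre (φ : Measure F) [φ.IsAddHaarMeasure] (j : F →+ V) (hj : Measurable j) (A₀ : V)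
    (D : Nn → F) (T : Nn → V → V) (hT : ∀ l A, T l A = A + j (D l)) (l : Nn) :
    MeasurePreserving (T l) (φ.map fun x => A₀ + j x) (φ.map fun x => A₀ + j x) := by
  have hTl : T l = fun A : V => A + j (D l) := funext (hT l)
  rw [hTl]
  exact ⟨measurable_add_const (j (D l)), map_translate_fibre φ j hj A₀ (D l)⟩

end Fibre

end Literature.MathematicalPhysics.QuantumFieldTheory.Balaban1983to89.B5Eq123Constants

end
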